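import Literature.NumberTheory.LFunctions.TrilinearKloostermanFractionsFromCbTools
import Literature.NumberTheory.LFunctions.TrilinearKloostermanFractionsWeilRange
import HarnessLib

/-!
# Trilinear forms with Kloosterman fractions: from (5.2) to (6.4) (Bettin–Chandee §6, general `A`)

Topic `NumberTheory/LFunctions`.  S. Bettin, V. Chandee, *Trilinear forms with Kloosterman
fractions*, Adv. Math. 328 (2018), §6: "We choose `B = N^{1/2}`, so that combining (6.2) and
(6.1) we obtain (6.3) … Notice that the third summand can be absorbed.  Indeed, if `M ≪ N²`, then
`AM^{6/5}N^{1/10} ≪ AMN^{3/4}`, whereas if `M ≫ N²` then one can obtain a stronger bound from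
Theorem 5 of [DFI97] … Moreover `AM^{1/2}N^{5/4} ≪ AMN^{3/4} + AN^{7/4}` and thus (6.4)."
This file PROVES that derivation for the general-`A`, TWISTED second moment (Remark 2), from the
tools of `TrilinearKloostermanFractionsFromCbTools.lean`, the squarefull sums of
`KloostermanFractionsSquarefull.lean` (`Z ≪ N^ε`) and the Weil range
`TrilinearKloostermanFractionsWeilRange.lean`:

* **`BC_C1A_bound_of_CbA_bound`** — hypothesis: (5.2) (general `A`, twisted) for every squarefull
  `b ≥ 1` coprime to `ϑ`, written out in the native form of the squarefull decomposition;
  conclusion: the (6.4)-type hypothesis `hC` of `BC_twisted73_MgeN_of_C1A_bound`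
  (`TrilinearKloostermanFractionsFromC1.lean`), whence (7.3) in the range `M ≥ N` and — with
  `TrilinearKloostermanFractionsReciprocity.lean` — the named fact
  `BettinChandee2018_trilinearKloostermanFractions`.

So, for the named fact, what remains of the source is exactly §2 (amplification) – §5: the bound
(5.2) for the amplified second moment with a FIXED squarefull `b`, general `A`, with the twist of
Remark 2 (the tree's `KloostermanFractions*.lean` pursue the case `A = 1`, untwisted).  No new
named facts (D-0026).

## References

* S. Bettin, V. Chandee, *Trilinear forms with Kloosterman fractions*, Adv. Math. 328 (2018)
  1234–1262, arXiv:1502.00769, §6 ((6.1)–(6.4)), (5.2), Remark 2. [BettinChandee2018]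
* W. Duke, J. Friedlander, H. Iwaniec, Invent. Math. 128 (1997) 23–43, Theorem 5.
  [DukeFriedlanderIwaniec1997]
-/

noncomputable section

open Finset Real

namespace Literature.NumberTheory.LFunctions

/-- **Bettin–Chandee §6 for the twisted trilinear second moment: from (5.2) to (6.4)**
(general `A`).  Hypothesis ((5.2) with Remark 2's twist, general `A`, in the native form produced by
the squarefull decomposition `BC_C1Atw_le_sum_sqfull` — the standing assumptions of §§3–5 of the
source: `b ≥ 1` squarefull and coprime to `ϑ`, `γ` supported on squarefree `N' < n' ≤ 2N'`
coprime to `b` and to `ϑ`, `b ≤ N'`, `bN' ≤ M`; the source's `M^ε` under "`A, b, ϑ, N ≪ M^C`"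
rendered as `((1+|ϑ|+|η|) bMN'A)^ε`, Remark 2's factor with exponent `1`): for every `ε > 0`
there is `K` with
`∑_{M<m≤2M,(m,b)=1} |∑_{n'≤2N',(n',m)=1} γ_{n'} ∑_a ν_a e(ϑ a m̄^{(bn')}/(bn') + η a/(m bn'))|²
 ≤ K ‖γ‖²‖ν‖² ((1+|ϑ|+|η|)bMN'A)^ε (1 + (|ϑ|+|η|)A/(bN'M))
   (AM(bN')^{1/2} + b^{3/4}AM^{1/2}N'^{5/4} + AM^{6/5}N'^{1/10}b^{-2/5} + b^{1/5}A^{2/5}M^{6/5}N'^{7/10} + A^{7/10}b^{1/2}M^{3/5}N'^{13/10} + b^{1/2}AN'^{7/4})`.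
Conclusion: the (6.4)-type hypothesis `hC` of `BC_twisted73_MgeN_of_C1A_bound`
(`TrilinearKloostermanFractionsFromC1.lean`).  Proof as in the source: `𝓒₁ ≤ Z ∑_b b^{1/2} 𝓒_b`
(`BC_C1Atw_le_sum_sqfull`), (5.2) for `b ≤ N^{1/2}` and the trivial bound for `b > N^{1/2}`
(`BC_sqrtb_CbA_le`), `∑_b ‖β_b‖² = ‖β‖²`, `Z ≪ N^ε` (`sum_sqfull_inv_sqrt_le`), the absorptions
`BC_terms6A_absorb` for `M ≤ 4N²`, and the Weil range `BC_C1Atw_weil_range` ("Theorem 5 of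
[DFI97]") for `M > 4N²`. [cite: BettinChandee2018, §6] -/
theorem BC_C1A_bound_of_CbA_bound
    (h52 : ∀ ε : ℝ, 0 < ε → ∃ K : ℝ, 0 < K ∧ ∀ (b : ℕ), 0 < b → (∀ p ∈ b.primeFactors, p ^ 2 ∣ b) →
      ∀ (M N' A : ℝ), 1 / 2 ≤ M → 1 / 2 ≤ N' → (b : ℝ) ≤ N' → (b : ℝ) * N' ≤ M → 1 / 2 ≤ A →
      ∀ (ϑ : ℤ), ϑ ≠ 0 → b.Coprime ϑ.natAbs → ∀ (η : ℝ) (γ ν : ℕ → ℂ),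
        (∀ n : ℕ, γ n ≠ 0 → N' < n ∧ (n : ℝ) ≤ 2 * N') →
        (∀ n : ℕ, γ n ≠ 0 → Squarefree n ∧ n.Coprime b ∧ n.Coprime ϑ.natAbs) →
        (∀ a : ℕ, ν a ≠ 0 → A < a ∧ (a : ℝ) ≤ 2 * A) →
        ∑ m ∈ (Ioc ⌊M⌋₊ ⌊2 * M⌋₊).filter (fun m => m.Coprime b),
            ‖∑ n' ∈ (Icc 1 ⌊2 * N'⌋₊).filter (fun n' => n'.Coprime m),
              γ n' * ∑ a ∈ Icc 1 ⌊2 * A⌋₊, ν a * Complex.exp (2 * Real.pi * Complex.I *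
                ((ϑ : ℂ) * (a : ℂ) * ((((m : ZMod (b * n'))⁻¹).val : ℕ) : ℂ) / ((b * n' : ℕ) : ℂ) +
                  (η : ℂ) * (a : ℂ) / ((m : ℂ) * ((b * n' : ℕ) : ℂ))))‖ ^ 2 ≤
          K * (∑ n ∈ Icc 1 ⌊2 * N'⌋₊, ‖γ n‖ ^ 2) * (∑ a ∈ Icc 1 ⌊2 * A⌋₊, ‖ν a‖ ^ 2) *
            ((1 + |(ϑ : ℝ)| + |η|) * ((b : ℝ) * M * N' * A)) ^ ε *
            (1 + (|(ϑ : ℝ)| + |η|) * A / ((b : ℝ) * N' * M)) *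
            (A * M * ((b : ℝ) * N') ^ (1 / 2 : ℝ) +
              (b : ℝ) ^ (3 / 4 : ℝ) * A * M ^ (1 / 2 : ℝ) * N' ^ (5 / 4 : ℝ) +
              A * M ^ (6 / 5 : ℝ) * N' ^ (1 / 10 : ℝ) * (b : ℝ) ^ (-(2 / 5) : ℝ) +
              (b : ℝ) ^ (1 / 5 : ℝ) * A ^ (2 / 5 : ℝ) * M ^ (6 / 5 : ℝ) * N' ^ (7 / 10 : ℝ) +
              A ^ (7 / 10 : ℝ) * (b : ℝ) ^ (1 / 2 : ℝ) * M ^ (3 / 5 : ℝ) * N' ^ (13 / 10 : ℝ) +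
              (b : ℝ) ^ (1 / 2 : ℝ) * A * N' ^ (7 / 4 : ℝ))) :
    ∀ ε : ℝ, 0 < ε → ∃ K : ℝ, 0 < K ∧
      ∀ (M N A : ℝ), 1 / 2 ≤ N → N ≤ M → 1 / 2 ≤ A → ∀ (ϑ : ℤ), ϑ ≠ 0 → ∀ (η : ℝ)
        (β ν : ℕ → ℂ),
        (∀ n : ℕ, β n ≠ 0 → N < n ∧ (n : ℝ) ≤ 2 * N) →
        (∀ a : ℕ, ν a ≠ 0 → A < a ∧ (a : ℝ) ≤ 2 * A) →
        (∀ n : ℕ, β n ≠ 0 → n.Coprime ϑ.natAbs) →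
        ∑ m ∈ Ioc ⌊M⌋₊ ⌊2 * M⌋₊, ‖∑ a ∈ Icc 1 ⌊2 * A⌋₊, ∑ n ∈ Icc 1 ⌊2 * N⌋₊,
            (if m.Coprime n then
              β n * ν a * Complex.exp (2 * Real.pi * Complex.I *
                ((ϑ : ℂ) * (a : ℂ) * ((((m : ZMod n)⁻¹).val : ℕ) : ℂ) / (n : ℂ) +
                  (η : ℂ) * (a : ℂ) / ((m : ℂ) * (n : ℂ))))
            else 0)‖ ^ 2 ≤
          K * (∑ n ∈ Icc 1 ⌊2 * N⌋₊, ‖β n‖ ^ 2) * (∑ a ∈ Icc 1 ⌊2 * A⌋₊, ‖ν a‖ ^ 2) *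
            ((1 + |(ϑ : ℝ)| + |η|) * (A * M * N)) ^ ε *
            (1 + (|(ϑ : ℝ)| + |η|) * A / (M * N)) *
            (A * M * N ^ (3 / 4 : ℝ) + A * N ^ (7 / 4 : ℝ) +
              A ^ (2 / 5 : ℝ) * M ^ (6 / 5 : ℝ) * N ^ (7 / 10 : ℝ) +
              A ^ (7 / 10 : ℝ) * M ^ (3 / 5 : ℝ) * N ^ (13 / 10 : ℝ)) := by
  intro ε hε
  obtain ⟨K₅, hK₅, h5⟩ := h52 (ε / 2) (by positivity)
  obtain ⟨CZ, hCZ, hZ⟩ := sum_sqfull_inv_sqrt_le (ε := ε / 2) (by positivity)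
  obtain ⟨KW, hKW, hWeil⟩ := BC_C1Atw_weil_range (ε := ε) hε
  obtain ⟨c8, hc8⟩ : ∃ c8 : ℝ, c8 = (8 : ℝ) ^ (ε / 2) := ⟨_, rfl⟩
  have hc80 : 0 < c8 := by rw [hc8]; positivity
  refine ⟨4 * KW + CZ * c8 * (5 * K₅ + 8 * c8), by positivity, ?_⟩
  intro M N A hN hNM hA ϑ hϑ η β ν hβ hν hβk
  have hM : 1 / 2 ≤ M := hN.trans hNM
  have hM0 : 0 < M := by linarith
  have hN0 : 0 < N := by linarith
  have hA0 : 0 < A := by linarith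
  have hQ0 : 0 < M * N := mul_pos hM0 hN0
  -- abbreviations (opaque)
  obtain ⟨X, hX⟩ : ∃ X : ℕ, X = ⌊2 * N⌋₊ := ⟨_, rfl⟩
  have hXpos : 0 < X := by rw [hX]; exact Nat.floor_pos.mpr (by linarith)
  have hXle : (X : ℝ) ≤ 2 * N := by rw [hX]; exact Nat.floor_le (by positivity)
  obtain ⟨nβ2, hnβ2⟩ : ∃ x : ℝ, x = ∑ n ∈ Icc 1 ⌊2 * N⌋₊, ‖β n‖ ^ 2 := ⟨_, rfl⟩
  have hnβ0 : 0 ≤ nβ2 := by rw [hnβ2]; exact Finset.sum_nonneg fun _ _ => sq_nonneg _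
  obtain ⟨nν2, hnν2⟩ : ∃ x : ℝ, x = ∑ a ∈ Icc 1 ⌊2 * A⌋₊, ‖ν a‖ ^ 2 := ⟨_, rfl⟩
  have hnν0 : 0 ≤ nν2 := by rw [hnν2]; exact Finset.sum_nonneg fun _ _ => sq_nonneg _
  obtain ⟨Eb, hEb⟩ : ∃ x : ℝ, x = (1 + |(ϑ : ℝ)| + |η|) * (A * M * N) := ⟨_, rfl⟩
  have h1ϑη : (1 : ℝ) ≤ 1 + |(ϑ : ℝ)| + |η| := by linarith [abs_nonneg (ϑ : ℝ), abs_nonneg η]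
  have hEb0 : 0 < Eb := by rw [hEb]; positivity
  obtain ⟨W, hW⟩ : ∃ x : ℝ, x = 1 + (|(ϑ : ℝ)| + |η|) * A / (M * N) := ⟨_, rfl⟩
  have hW1 : 1 ≤ W := by
    have : 0 ≤ (|(ϑ : ℝ)| + |η|) * A / (M * N) := by positivity
    rw [hW]; linarith
  have hW0 : 0 ≤ W := by linarith
  obtain ⟨S₄, hS₄⟩ : ∃ x : ℝ, x = A * M * N ^ (3 / 4 : ℝ) + A * N ^ (7 / 4 : ℝ) +
      A ^ (2 / 5 : ℝ) * M ^ (6 / 5 : ℝ) * N ^ (7 / 10 : ℝ) +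
      A ^ (7 / 10 : ℝ) * M ^ (3 / 5 : ℝ) * N ^ (13 / 10 : ℝ) := ⟨_, rfl⟩
  have hMN340 : 0 ≤ A * M * N ^ (3 / 4 : ℝ) := by positivity
  have hMN34S : A * M * N ^ (3 / 4 : ℝ) ≤ S₄ := by
    have p2 : 0 ≤ A * N ^ (7 / 4 : ℝ) := by positivity
    have p3 : 0 ≤ A ^ (2 / 5 : ℝ) * M ^ (6 / 5 : ℝ) * N ^ (7 / 10 : ℝ) := by positivity
    have p4 : 0 ≤ A ^ (7 / 10 : ℝ) * M ^ (3 / 5 : ℝ) * N ^ (13 / 10 : ℝ) := by positivity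
    rw [hS₄]; linarith
  have hS₄0 : 0 ≤ S₄ := hMN340.trans hMN34S
  have hAMS : A * M ≤ 2 * S₄ := by
    -- `N^{3/4} ≥ (1/2)^{3/4} ≥ 1/2`
    have h1 : (1 / 2 : ℝ) ≤ N ^ (3 / 4 : ℝ) := by
      have h2 : (1 / 2 : ℝ) ^ (3 / 4 : ℝ) ≤ N ^ (3 / 4 : ℝ) :=
        Real.rpow_le_rpow (by norm_num) hN (by norm_num)
      have h3 : (1 / 2 : ℝ) ≤ (1 / 2 : ℝ) ^ (3 / 4 : ℝ) := by
        calc (1 / 2 : ℝ) = (1 / 2 : ℝ) ^ (1 : ℝ) := (Real.rpow_one _).symm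
          _ ≤ (1 / 2 : ℝ) ^ (3 / 4 : ℝ) :=
            Real.rpow_le_rpow_of_exponent_ge (by norm_num) (by norm_num) (by norm_num)
      linarith
    have hAM0 : 0 ≤ A * M := by positivity
    calc A * M = 2 * (A * M * (1 / 2)) := by ring
      _ ≤ 2 * (A * M * N ^ (3 / 4 : ℝ)) := by gcongr
      _ ≤ 2 * S₄ := by linarith
  -- `2N ≤ 8 Eb`, `(X)^{ε/2} ≤ c8 Eb^{ε/2}`, `1 ≤ c8 Eb^{ε/2}`, `Eb^{ε/2} Eb^{ε/2} = Eb^ε`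
  have h2N : 2 * N ≤ 8 * Eb := by
    calc 2 * N = 1 * (8 * ((1 / 2) * (1 / 2) * N)) := by ring
      _ ≤ (1 + |(ϑ : ℝ)| + |η|) * (8 * (A * M * N)) := by gcongr
      _ = 8 * Eb := by rw [hEb]; ring
  have h8Eb : (8 * Eb) ^ (ε / 2) = c8 * Eb ^ (ε / 2) := by
    rw [hc8]; exact Real.mul_rpow (by norm_num) hEb0.le
  have hXε : (X : ℝ) ^ (ε / 2) ≤ c8 * Eb ^ (ε / 2) := by
    rw [← h8Eb]
    exact Real.rpow_le_rpow (by positivity) (hXle.trans h2N) (by positivity)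
  have hone : 1 ≤ c8 * Eb ^ (ε / 2) := by
    rw [← h8Eb]
    exact Real.one_le_rpow (by linarith) (by positivity)
  have hEE : Eb ^ (ε / 2) * Eb ^ (ε / 2) = Eb ^ ε := by
    rw [← Real.rpow_add hEb0]; ring_nf
  -- the target quantity
  obtain ⟨T, hT⟩ : ∃ x : ℝ, x = nβ2 * nν2 * Eb ^ ε * W * S₄ := ⟨_, rfl⟩
  have hT0 : 0 ≤ T := by rw [hT]; positivity
  suffices hmain : ∑ m ∈ Ioc ⌊M⌋₊ ⌊2 * M⌋₊, ‖∑ a ∈ Icc 1 ⌊2 * A⌋₊, ∑ n ∈ Icc 1 ⌊2 * N⌋₊,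
      (if m.Coprime n then
        β n * ν a * Complex.exp (2 * Real.pi * Complex.I *
          ((ϑ : ℂ) * (a : ℂ) * ((((m : ZMod n)⁻¹).val : ℕ) : ℂ) / (n : ℂ) +
            (η : ℂ) * (a : ℂ) / ((m : ℂ) * (n : ℂ))))
      else 0)‖ ^ 2 ≤ (4 * KW + CZ * c8 * (5 * K₅ + 8 * c8)) * T by
    rw [hT, hnβ2, hnν2, hS₄, hEb, hW] at hmain
    calc _ ≤ _ := hmain
      _ = _ := by ring
  by_cases hcase : 4 * N ^ 2 < M
  · -- Case `M > 4N²`: the Weil range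
    have hweil := hWeil M N A hM hN hA ϑ hϑ η β ν hβ
    clear h5 hWeil hZ
    rw [← hnβ2, ← hnν2, ← hEb, ← hW] at hweil
    have hMN2 : A * (M + N ^ 2) ≤ 4 * S₄ := by
      have h1 : M + N ^ 2 ≤ 2 * M := by linarith
      calc A * (M + N ^ 2) ≤ A * (2 * M) := by gcongr
        _ = 2 * (A * M) := by ring
        _ ≤ 2 * (2 * S₄) := by gcongr
        _ = 4 * S₄ := by ring
    calc _ ≤ _ := hweil
      _ ≤ KW * nβ2 * nν2 * Eb ^ ε * W * (4 * S₄) := by gcongr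
      _ = 4 * KW * T := by rw [hT]; ring
      _ ≤ (4 * KW + CZ * c8 * (5 * K₅ + 8 * c8)) * T := by
          have e1 : 0 ≤ CZ * c8 * (5 * K₅ + 8 * c8) * T := by positivity
          rw [add_mul]; exact le_add_of_nonneg_right e1
  · -- Case `M ≤ 4N²`: Bettin–Chandee §6
    have hM4N : M ≤ 4 * N ^ 2 := not_lt.mp hcase
    obtain ⟨T6, hT6⟩ : ∃ T6 : ℝ, T6 = A * M * N ^ (3 / 4 : ℝ) + A * M ^ (1 / 2 : ℝ) * N ^ (5 / 4 : ℝ) +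
        A * M ^ (6 / 5 : ℝ) * N ^ (1 / 10 : ℝ) + A ^ (2 / 5 : ℝ) * M ^ (6 / 5 : ℝ) * N ^ (7 / 10 : ℝ) +
        A ^ (7 / 10 : ℝ) * M ^ (3 / 5 : ℝ) * N ^ (13 / 10 : ℝ) + A * N ^ (7 / 4 : ℝ) := ⟨_, rfl⟩
    have h6' : T6 ≤ 5 * S₄ := by rw [hT6, hS₄]; exact BC_terms6A_absorb hM0 hN hA0 hM4N
    obtain ⟨E5, hE5⟩ : ∃ E5 : ℝ, E5 = K₅ * ((1 + |(ϑ : ℝ)| + |η|) * (A * M * N)) ^ (ε / 2) *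
        (1 + (|(ϑ : ℝ)| + |η|) * A / (M * N)) := ⟨_, rfl⟩
    have hE5' : E5 = K₅ * Eb ^ (ε / 2) * W := by rw [hE5, hEb, hW]
    have hE50 : 0 ≤ E5 := by rw [hE5']; positivity
    obtain ⟨Φ, hΦ⟩ : ∃ Φ : ℝ, Φ = E5 * T6 + 8 * (A * M * N ^ (3 / 4 : ℝ)) := ⟨_, rfl⟩
    -- per-`b` bound (`BC_sqrtb_CbA_le`)
    have hper : ∀ b ∈ (Icc 1 X).filter (fun b => ∀ p ∈ b.primeFactors, p ^ 2 ∣ b),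
        Real.sqrt b * ∑ m ∈ (Ioc ⌊M⌋₊ ⌊2 * M⌋₊).filter (fun m => m.Coprime b),
          ‖∑ n' ∈ (Icc 1 ⌊2 * (N / b)⌋₊).filter (fun n' => n'.Coprime m),
            (fun n' => if Squarefree n' ∧ n'.Coprime b then β (b * n') else 0) n' *
              ∑ a ∈ Icc 1 ⌊2 * A⌋₊, ν a * Complex.exp (2 * Real.pi * Complex.I *
                ((ϑ : ℂ) * (a : ℂ) * ((((m : ZMod (b * n'))⁻¹).val : ℕ) : ℂ) / ((b * n' : ℕ) : ℂ) +
                  (η : ℂ) * (a : ℂ) / ((m : ℂ) * ((b * n' : ℕ) : ℂ))))‖ ^ 2 ≤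
        (∑ n' ∈ Icc 1 ⌊2 * (N / b)⌋₊,
          ‖(fun n' => if Squarefree n' ∧ n'.Coprime b then β (b * n') else 0) n'‖ ^ 2) *
          (nν2 * Φ) := by
      intro b hb
      rw [Finset.mem_filter, Finset.mem_Icc] at hb
      have h := BC_sqrtb_CbA_le (ε := ε / 2) hK₅ hM hN hNM hA hϑ η ν hβ hβk hν h5 hb.1.1 hb.2
        (fun n' => if Squarefree n' ∧ n'.Coprime b then β (b * n') else 0)
        (by
          intro n' hn'
          have hn'' : (if Squarefree n' ∧ n'.Coprime b then β (b * n') else 0) ≠ 0 := hn'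
          by_cases hc : Squarefree n' ∧ n'.Coprime b
          · rw [if_pos hc] at hn''
            exact ⟨hc.1, hc.2, hn''⟩
          · rw [if_neg hc] at hn''
            exact absurd rfl hn'')
      rw [hΦ, hE5, hT6, hnν2]; exact h
    clear h5 hWeil
    -- summing over `b`: `∑_b ‖β_b‖² = ‖β‖²`
    have hfl : ∀ b : ℕ, ⌊2 * (N / b)⌋₊ = X / b := fun b => by
      rw [hX, show (2 : ℝ) * (N / b) = 2 * N / b by ring, Nat.floor_div_natCast]
    have hsumβ : ∑ b ∈ (Icc 1 X).filter (fun b => ∀ p ∈ b.primeFactors, p ^ 2 ∣ b),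
        (∑ n' ∈ Icc 1 ⌊2 * (N / b)⌋₊,
          ‖(fun n' => if Squarefree n' ∧ n'.Coprime b then β (b * n') else 0) n'‖ ^ 2) = nβ2 := by
      rw [hnβ2, ← hX, ← sum_sqfull_normSq_betab_eq X β]
      refine Finset.sum_congr rfl fun b _ => ?_
      rw [hfl b]
    have hsum : ∑ b ∈ (Icc 1 X).filter (fun b => ∀ p ∈ b.primeFactors, p ^ 2 ∣ b),
        Real.sqrt b * ∑ m ∈ (Ioc ⌊M⌋₊ ⌊2 * M⌋₊).filter (fun m => m.Coprime b),
          ‖∑ n' ∈ (Icc 1 ⌊2 * (N / b)⌋₊).filter (fun n' => n'.Coprime m),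
            (fun n' => if Squarefree n' ∧ n'.Coprime b then β (b * n') else 0) n' *
              ∑ a ∈ Icc 1 ⌊2 * A⌋₊, ν a * Complex.exp (2 * Real.pi * Complex.I *
                ((ϑ : ℂ) * (a : ℂ) * ((((m : ZMod (b * n'))⁻¹).val : ℕ) : ℂ) / ((b * n' : ℕ) : ℂ) +
                  (η : ℂ) * (a : ℂ) / ((m : ℂ) * ((b * n' : ℕ) : ℂ))))‖ ^ 2 ≤
        nβ2 * (nν2 * Φ) := by
      refine (Finset.sum_le_sum hper).trans (le_of_eq ?_)
      rw [← Finset.sum_mul, hsumβ]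
    -- `Z ≤ CZ X^{ε/2} ≤ CZ c8 Eb^{ε/2}`
    have hZle : ∑ b ∈ (Icc 1 X).filter (fun b => ∀ p ∈ b.primeFactors, p ^ 2 ∣ b),
        (Real.sqrt b)⁻¹ ≤ CZ * (c8 * Eb ^ (ε / 2)) :=
      (hZ X hXpos).trans (by gcongr)
    -- `Φ ≤ (5 K₅ + 8 c8) Eb^{ε/2} W S₄`
    have hΦle : Φ ≤ (5 * K₅ + 8 * c8) * (Eb ^ (ε / 2) * W * S₄) := by
      have hT60 : 0 ≤ T6 := by
        have p1 : 0 ≤ A * M * N ^ (3 / 4 : ℝ) := by positivity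
        have p2 : 0 ≤ A * M ^ (1 / 2 : ℝ) * N ^ (5 / 4 : ℝ) := by positivity
        have p3 : 0 ≤ A * M ^ (6 / 5 : ℝ) * N ^ (1 / 10 : ℝ) := by positivity
        have p4 : 0 ≤ A ^ (2 / 5 : ℝ) * M ^ (6 / 5 : ℝ) * N ^ (7 / 10 : ℝ) := by positivity
        have p5 : 0 ≤ A ^ (7 / 10 : ℝ) * M ^ (3 / 5 : ℝ) * N ^ (13 / 10 : ℝ) := by positivity
        have p6 : 0 ≤ A * N ^ (7 / 4 : ℝ) := by positivity
        rw [hT6]; linarith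
      have b1 : E5 * T6 ≤ K₅ * Eb ^ (ε / 2) * W * (5 * S₄) := by
        rw [hE5']; exact mul_le_mul_of_nonneg_left h6' (by positivity)
      have b2 : 8 * (A * M * N ^ (3 / 4 : ℝ)) ≤ 8 * S₄ * (c8 * Eb ^ (ε / 2)) * W := by
        have p0 : 0 ≤ 8 * S₄ := by linarith
        have e1 : 8 * (A * M * N ^ (3 / 4 : ℝ)) ≤ 8 * S₄ := by linarith
        have e2 : 8 * S₄ ≤ 8 * S₄ * (c8 * Eb ^ (ε / 2)) := le_mul_of_one_le_right p0 hone
        have p1 : 0 ≤ 8 * S₄ * (c8 * Eb ^ (ε / 2)) := mul_nonneg p0 (by positivity)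
        have e3 : 8 * S₄ * (c8 * Eb ^ (ε / 2)) ≤ 8 * S₄ * (c8 * Eb ^ (ε / 2)) * W :=
          le_mul_of_one_le_right p1 hW1
        linarith
      calc Φ = E5 * T6 + 8 * (A * M * N ^ (3 / 4 : ℝ)) := hΦ
        _ ≤ K₅ * Eb ^ (ε / 2) * W * (5 * S₄) + 8 * S₄ * (c8 * Eb ^ (ε / 2)) * W := add_le_add b1 b2
        _ = (5 * K₅ + 8 * c8) * (Eb ^ (ε / 2) * W * S₄) := by ring
    have hΦ0 : 0 ≤ Φ := by
      have hT60 : A * M * N ^ (3 / 4 : ℝ) ≤ T6 := by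
        have p2 : 0 ≤ A * M ^ (1 / 2 : ℝ) * N ^ (5 / 4 : ℝ) := by positivity
        have p3 : 0 ≤ A * M ^ (6 / 5 : ℝ) * N ^ (1 / 10 : ℝ) := by positivity
        have p4 : 0 ≤ A ^ (2 / 5 : ℝ) * M ^ (6 / 5 : ℝ) * N ^ (7 / 10 : ℝ) := by positivity
        have p5 : 0 ≤ A ^ (7 / 10 : ℝ) * M ^ (3 / 5 : ℝ) * N ^ (13 / 10 : ℝ) := by positivity
        have p6 : 0 ≤ A * N ^ (7 / 4 : ℝ) := by positivity
        rw [hT6]; linarith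
      rw [hΦ]; exact add_nonneg (mul_nonneg hE50 (hMN340.trans hT60)) (by positivity)
    -- assemble
    have hsq := BC_C1Atw_le_sum_sqfull M N A ϑ η β ν
    rw [hX] at hZle hsum
    calc _ ≤ _ := hsq
      _ ≤ (CZ * (c8 * Eb ^ (ε / 2))) * (nβ2 * (nν2 * Φ)) := by
          refine mul_le_mul hZle hsum ?_ (by positivity)
          exact Finset.sum_nonneg fun b _ => mul_nonneg (Real.sqrt_nonneg _)
            (Finset.sum_nonneg fun _ _ => sq_nonneg _)
      _ ≤ (CZ * (c8 * Eb ^ (ε / 2))) * (nβ2 * (nν2 * ((5 * K₅ + 8 * c8) *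
            (Eb ^ (ε / 2) * W * S₄)))) := by gcongr
      _ = CZ * c8 * (5 * K₅ + 8 * c8) * (nβ2 * nν2 * (Eb ^ (ε / 2) * Eb ^ (ε / 2)) * W * S₄) := by
          ring
      _ = CZ * c8 * (5 * K₅ + 8 * c8) * T := by rw [hEE, hT]
      _ ≤ (4 * KW + CZ * c8 * (5 * K₅ + 8 * c8)) * T := by
          have e1 : 0 ≤ 4 * KW * T := by positivity
          rw [add_mul]; exact le_add_of_nonneg_left e1

end Literature.NumberTheory.LFunctions

end
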